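import Literature.IUT.HodgeTheaters.TemperedCoveringsProSigmaInertia
import HarnessLib

/-!
# [IUTchI] Cor. 2.5, inertia part: the pro-`Σ` atom for finite-index subgroups of CONJUGATES of `I_x`, PROOFS

Mochizuki, *Inter-universal Teichmüller theory I*, kurims manuscript (May 2020), §2, proof of
Cor. 2.5, p. 51 [cite: Mochizuki2012, Cor 2.5 p.51] (D-0012 claim key; series status DISPUTED —
nothing on this page is contested): "by applying Proposition 2.4, (i), to the unique maximal
pro-`Σ` subgroup of `I_x`".  PROOF-ONLY sequel of `TemperedCoveringsProSigmaInertia` (abc-iut-L5-t11;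
no definitions, nothing printed is asserted).  Downstream ([IUTchII] Cor. 2.4 (i), kernel
`Literature.IUT.HodgeArakelov.cor24_i_of_inputs`, input (A); GAP-LEDGER G-w4d012-1; the bridge of
abc-iut-w5-d121) the atom is consumed for FINITE-INDEX subgroups `J` of the `Π̂_X`-image of a
`Π^tp_X`-CONJUGATE `t I_x t⁻¹` of a cusp inertia group, in the shape
`J ≤ ι(t · I_x · t⁻¹)`, `[ι(t I_x t⁻¹) : J] < ∞` `⟹ ∃ P ⊆ Δ^tp_X` compact, nontrivial, pro-`Σ`, with
`ι(P) ⊆ J`.  We derive exactly that shape from "`I_x ≅ Ẑ(1)`"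
(`StableCurveTemperedData.proSigmaAtom_conj_finiteIndex_of_equiv_zHat`): pull `J` back to a
finite-index subgroup of `I_x` along `i ↦ ι(t i t⁻¹)`, take its pro-`Σ` part there
(`proSigmaAtom_le_of_finiteIndex_of_equiv_zHat`), and conjugate by `t` inside the normal subgroup
`Δ^tp_X` (`proSigmaAtom_map_conjNormal`: compactness, nontriviality and pro-`Σ`-ness are invariant).
-/

namespace Literature.IUT.HodgeTheaters

open Pointwise Topology
open Literature.AnabelianGeometry.SemiGraphs (IsProSigma)

universe u

namespace StableCurveTemperedData

variable (D : StableCurveTemperedData.{u})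

/-- Conjugation by `t ∈ Π^tp_X` on the normal subgroup `Δ^tp_X` is continuous (for the subspace
topology). [cite: Mochizuki2012, Cor 2.5 p.51] -/
theorem continuous_conjNormal_deltaTp (t : D.PiTp) :
    Continuous (MulAut.conjNormal (H := D.DeltaTp) t : D.DeltaTp → D.DeltaTp) := by
  refine continuous_induced_rng.2 ?_
  have e : (Subtype.val ∘ (MulAut.conjNormal (H := D.DeltaTp) t : D.DeltaTp → D.DeltaTp)) =
      fun d : D.DeltaTp => t * (d : D.PiTp) * t⁻¹ :=
    funext fun d => MulAut.conjNormal_apply t d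
  rw [e]
  exact (continuous_const.mul continuous_subtype_val).mul continuous_const

/-- **The atom is conjugation-invariant**: if `P ⊆ Δ^tp_X` is a nontrivial compact pro-`Σ` subgroup,
so is `t P t⁻¹` for `t ∈ Π^tp_X`. [cite: Mochizuki2012, Cor 2.5 p.51] -/
theorem proSigmaAtom_map_conjNormal (t : D.PiTp) {S : Set ℕ} {P : Subgroup D.DeltaTp}
    (hc : IsCompact (P : Set D.DeltaTp)) (hne : P ≠ ⊥) (hS : IsProSigma S P) :
    IsCompact ((P.map (MulAut.conjNormal (H := D.DeltaTp) t).toMonoidHom : Subgroup D.DeltaTp) :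
        Set D.DeltaTp) ∧
      P.map (MulAut.conjNormal (H := D.DeltaTp) t).toMonoidHom ≠ ⊥ ∧
      IsProSigma S ↥(P.map (MulAut.conjNormal (H := D.DeltaTp) t).toMonoidHom) := by
  have hcont := D.continuous_conjNormal_deltaTp t
  have hinj : Function.Injective (MulAut.conjNormal (H := D.DeltaTp) t).toMonoidHom :=
    (MulAut.conjNormal (H := D.DeltaTp) t).injective
  refine ⟨?_, ?_, ?_⟩
  · rw [Subgroup.coe_map]
    exact hc.image hcont
  · rwa [Ne, Subgroup.map_eq_bot_iff_of_injective _ hinj]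
  · refine isProSigma_of_surjective hS
      (Subgroup.equivMapOfInjective P _ hinj).toMonoidHom ?_
      (Subgroup.equivMapOfInjective P _ hinj).surjective
    refine continuous_induced_rng.2 ?_
    exact (hcont.comp continuous_subtype_val).congr fun _ => rfl

/-- **The pro-`Σ` atom for finite-index subgroups of conjugates of `I_x ≅ Ẑ(1)`** (the shape consumed
by [IUTchII] Cor. 2.4 (i) (A) / GAP-LEDGER G-w4d012-1): if each cusp inertia group `I_x ⊆ Δ^tp_X` is
identified with `Ẑ`, then for every cusp `x`, every `t ∈ Π^tp_X` and every subgroup `J ⊆ Π̂_X`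
meeting the image `ι(t I_x t⁻¹)` with finite index [no inclusion `J ⊆ ι(t I_x t⁻¹)` is needed],
there is a nontrivial compact pro-`Σ` subgroup `P ⊆ Δ^tp_X` with `ι(P) ⊆ J` — namely `t P' t⁻¹` for
`P'` the pro-`Σ` part of the pull-back of `J` to `I_x`. [cite: Mochizuki2012, Cor 2.5 p.51] -/
theorem proSigmaAtom_conj_finiteIndex_of_equiv_zHat (e : ∀ x : D.Cusp, ↥(D.inertiaTp x) ≃ₜ* ZHat)
    (x : D.Cusp) (t : D.PiTp) (J : Subgroup D.PiHat)
    (hfi : (J.subgroupOf ((MulAut.conj t • (D.inertiaTp x).map D.DeltaTp.subtype).map D.ιX)).FiniteIndex) :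
    ∃ P : Subgroup D.DeltaTp, (P.map D.DeltaTp.subtype).map D.ιX ≤ J ∧
      IsCompact (P : Set D.DeltaTp) ∧ P ≠ ⊥ ∧ IsProSigma D.graph.Sigma P := by
  -- `φ : I_x → Π̂_X`, `i ↦ ι(t i t⁻¹)`
  let φ : ↥(D.inertiaTp x) →* D.PiHat :=
    D.ιX.comp ((MulAut.conj t).toMonoidHom.comp (D.DeltaTp.subtype.comp (D.inertiaTp x).subtype))
  have hφ : ∀ i, φ i = D.ιX (t * ((i : D.DeltaTp) : D.PiTp) * t⁻¹) := fun i => rfl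
  have hrange : φ.range = (MulAut.conj t • (D.inertiaTp x).map D.DeltaTp.subtype).map D.ιX := by
    ext y
    simp only [MonoidHom.mem_range, hφ, Subgroup.mem_map, Subgroup.mem_smul_pointwise_iff_exists,
      MulAut.smul_def, MulAut.conj_apply, Subgroup.coe_subtype]
    constructor
    · rintro ⟨i, rfl⟩
      exact ⟨t * ((i : D.DeltaTp) : D.PiTp) * t⁻¹, ⟨(i : D.DeltaTp), ⟨(i : D.DeltaTp), i.2, rfl⟩, rfl⟩,
        rfl⟩
    · rintro ⟨z, ⟨s, ⟨d, hd, rfl⟩, rfl⟩, rfl⟩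
      exact ⟨⟨d, hd⟩, rfl⟩
  -- the pull-back `J' := φ⁻¹(J)` has finite index in `I_x`
  haveI : (J.comap φ).FiniteIndex := by
    refine ⟨?_⟩
    rw [Subgroup.index_comap, hrange]
    exact hfi.index_ne_zero
  obtain ⟨P', hP'le, hc, hne, hS⟩ := D.proSigmaAtom_le_of_finiteIndex_of_equiv_zHat (e x) (J.comap φ)
  -- conjugate `P'` by `t` inside `Δ^tp_X`
  have hcapply : ∀ d : D.DeltaTp,
      (((MulAut.conjNormal (H := D.DeltaTp) t) d : D.DeltaTp) : D.PiTp) = t * (d : D.PiTp) * t⁻¹ :=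
    fun d => MulAut.conjNormal_apply t d
  obtain ⟨hc', hne', hS'⟩ := D.proSigmaAtom_map_conjNormal t hc hne hS
  refine ⟨P'.map (MulAut.conjNormal (H := D.DeltaTp) t).toMonoidHom, ?_, hc', hne', hS'⟩
  rintro y ⟨z, ⟨d, ⟨p, hp, rfl⟩, rfl⟩, rfl⟩
  obtain ⟨j, hj, rfl⟩ := hP'le hp
  have hj' : D.ιX (t * ((j : D.DeltaTp) : D.PiTp) * t⁻¹) ∈ J := hj
  have e1 : D.DeltaTp.subtype ((MulAut.conjNormal (H := D.DeltaTp) t).toMonoidHom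
      ((D.inertiaTp x).subtype j)) = t * ((j : D.DeltaTp) : D.PiTp) * t⁻¹ := hcapply _
  rw [e1]
  exact hj'

/-- The same in the exact quantifier shape of the downstream hypothesis `hP` (with the — here
superfluous — inclusion `J ⊆ ι(t I_x t⁻¹)` as an ignored premise). [cite: Mochizuki2012, Cor 2.5 p.51] -/
theorem proSigmaAtom_conj_finiteIndex_of_equiv_zHat' (e : ∀ x : D.Cusp, ↥(D.inertiaTp x) ≃ₜ* ZHat) :
    ∀ (x : D.Cusp) (t : D.PiTp) (J : Subgroup D.PiHat),
      J ≤ (MulAut.conj t • (D.inertiaTp x).map D.DeltaTp.subtype).map D.ιX →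
      (J.subgroupOf ((MulAut.conj t • (D.inertiaTp x).map D.DeltaTp.subtype).map D.ιX)).FiniteIndex →
        ∃ P : Subgroup D.DeltaTp, (P.map D.DeltaTp.subtype).map D.ιX ≤ J ∧
          IsCompact (P : Set D.DeltaTp) ∧ P ≠ ⊥ ∧ IsProSigma D.graph.Sigma P :=
  fun x t J _ hfi => D.proSigmaAtom_conj_finiteIndex_of_equiv_zHat e x t J hfi

end StableCurveTemperedData

end Literature.IUT.HodgeTheaters
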